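import Summits.ValiantsHypothesis.ValiantsHypothesis.Theorems.GrenetZeonDualUnipotentThreeHalvesHeavyTopIotaFourAssembly
import Summits.ValiantsHypothesis.ValiantsHypothesis.Theorems.GrenetZeonDualUnipotentThreeHalvesHeavyTopIotaFourCyclic

/-!
# `GrenetZeon.DualUnipotentThreeHalves` (stmt-ValiantsHypothesis-24318), R2 `HeavyTopLaw` — ★ ι(4) = 3 IN THE KERNEL,
# unconditionally: every linear space of nilpotent `4 × 4` complex matrices of dimension `≥ 4` is reducible (htc PREREG Q2)

The one-line discharge announced in ✓ `…HeavyTopIotaFourAssembly` (val-htc-eng-1 g0, `reducible_of_four_le_finrank_of_jordan`,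
which takes the two Jordan normal forms as hypotheses): the normal forms are ✓ `exists_conj_eq_J4` and ✓
`exists_conj_eq_E12_E23` of `…HeavyTopIotaFourCyclic` (val-port-3 g2, p657719), whose statements are those hypotheses
verbatim.  Hence `reducible_of_four_le_finrank` (eng-1's spec target, no hypotheses beyond nilpotency and `dim ≥ 4`) and
its contrapositive `finrank_le_three_of_irreducible`: an IRREDUCIBLE nilpotent subspace of `M₄(ℂ)` has dimension `≤ 3` —
sharp by `Irr(4,3)` (✓ `HeavyTopIrreducibleData.irrFour_irreducible`), i.e. **ι(4) = 3**.  The whole proof is eng-1's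
`NOTE-iota4.md` (replication PASS val-htc-lead): (T1) ✓ p654162/p655736, (T2) ✓ p655235/p655522/p655765, assembly ✓
eng-1, normal forms ✓ p657719 (an independent transport package is ✓ `…HeavyTopIotaFourConjugation`, p657700).

Consequence for the instance table (INSTANCES.md §7/§10): the (4,6) hypothesis ι(4) ≤ 3 is DISCHARGED in the kernel;
(4,6) remains OPEN ⟸ ι(5) ≤ 7 (machine-certified, kernel open) ∧ ι(6) ≤ 11 (Q4 running).
Honest framing: a datum of the instance table; nothing here proves or refutes `HeavyTopLaw`, 24318, S3b or 8062;
`VP ≠ VNP` is not moved; no summit statement is proved here.  No definitions, no named facts.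
[eng-1 NOTE-iota4; kernel: val-htc-eng-1 g0 + val-port-3 g2]
-/

noncomputable section

-- single-conjunct layout: Sub = Summit, duplicated namespace component intended
set_option linter.dupNamespace false

namespace Summit.ValiantsHypothesis.ValiantsHypothesis.Theorems.GrenetZeon.HeavyTopIotaFour

open Matrix

/-- **ι(4) = 3 (unconditional).**  Every linear space of nilpotent `4 × 4` complex matrices of dimension at least `4`
has a common invariant subspace `U` with `0 ≠ U ≠ ℂ⁴`. [eng-1 NOTE-iota4; ✓ `reducible_of_four_le_finrank_of_jordan` +
✓ `exists_conj_eq_J4` + ✓ `exists_conj_eq_E12_E23`] -/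
theorem reducible_of_four_le_finrank (V : Submodule ℂ (Matrix (Fin 4) (Fin 4) ℂ)) (hV : ∀ A ∈ V, IsNilpotent A)
    (hdim : 4 ≤ Module.finrank ℂ V) :
    ∃ U : Submodule ℂ (Fin 4 → ℂ), U ≠ ⊥ ∧ U ≠ ⊤ ∧ ∀ A ∈ V, ∀ u ∈ U, A *ᵥ u ∈ U :=
  reducible_of_four_le_finrank_of_jordan exists_conj_eq_J4 exists_conj_eq_E12_E23 V hV hdim

/-- **ι(4) = 3, contrapositive form**: an IRREDUCIBLE nilpotent subspace of `M₄(ℂ)` (only `⊥` and `⊤` are invariant)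
has dimension at most `3` — sharp by `Irr(4,3)` (✓ `irrFour_irreducible`, `irrFour_independent`). [NOTE-iota4] -/
theorem finrank_le_three_of_irreducible (V : Submodule ℂ (Matrix (Fin 4) (Fin 4) ℂ)) (hV : ∀ A ∈ V, IsNilpotent A)
    (hirr : ∀ U : Submodule ℂ (Fin 4 → ℂ), (∀ A ∈ V, ∀ u ∈ U, A *ᵥ u ∈ U) → U = ⊥ ∨ U = ⊤) :
    Module.finrank ℂ V ≤ 3 := by
  by_contra h
  push Not at h
  obtain ⟨U, hbot, htop, hinv⟩ := reducible_of_four_le_finrank V hV h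
  rcases hirr U hinv with h' | h'
  · exact hbot h'
  · exact htop h'

end Summit.ValiantsHypothesis.ValiantsHypothesis.Theorems.GrenetZeon.HeavyTopIotaFour

end
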